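import Literature.Geometry.Riemannian.SliceLipschitzNearLevel
import Literature.Geometry.Riemannian.SpherePresentation
import Mathlib.Analysis.Calculus.ContDiff.RCLike
import HarnessLib

/-!
# Collar data of the interior surgery: the radial defect and the angular drift of the cone map

Topic `Geometry/Riemannian`. Let `C : V → V` (the coordinate expression of the collar cone map of
the boundary sphere in the round picture of Weinstein's disk; Weinstein 1968, proof of the main
theorem, step (3)) be `C^∞` on an annulus `{1-ε < ‖v‖ < 1+ε}` with `C u = u` on the unit sphere.
With the normalisation `N v = v/‖v‖` we consider, for `σ` near `1` and `u ≠ 0`,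

* the **radial defect** `d(σ, u) = ‖C(σ N u)‖ - σ` and
* the **angular drift** `w(σ, u) = N(C(σ N u)) - N u`,

both `0`-homogeneous in `u` and vanishing at `σ = 1`. This file proves that they are `C¹` on
`(1-ε', 1+ε') × (V ∖ {0})` for a suitable `ε' ≤ ε` (where `‖C - N‖ < 1/2`, so `C ≠ 0`;
`exists_collar_width`, `contDiffOn_radialDefect`, `contDiffOn_angularDrift`) and vanish at
`σ = 1` (`radialDefect_one`, `angularDrift_one`); the generic lemmas of `UniformNearLevel.lean` and
`SliceLipschitzNearLevel.lean` then make them uniformly small with small `u`-Lipschitz constants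
near `σ = 1` (`exists_collar_estimates`).

## References

* A. Weinstein, Ann. of Math. (2) 87 (1968), 29–41, proof of the main theorem, step (3).
  [cite: Weinstein1968]

Tags: [ConeMap] [Weinstein1968]
-/

noncomputable section

open Set Function Metric Filter
open scoped Topology RealInnerProductSpace

namespace Literature.Geometry.Riemannian

variable {V : Type*} [NormedAddCommGroup V] [InnerProductSpace ℝ V] [FiniteDimensional ℝ V]

/-- **A collar width on which `C` stays close to `N`.** If `C` is continuous on the annulus
`{1-ε < ‖v‖ < 1+ε}` (`ε ≤ 1`) and `C u = u` on the unit sphere, then for every `κ > 0` there is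
`ε' ∈ (0, ε)` with `‖C(σ N u) - N u‖ < κ` for `|σ - 1| ≤ ε'`, `u ≠ 0`. [folklore] -/
theorem exists_collar_width {C : V → V} {ε : ℝ} (hε : 0 < ε) (hε1 : ε ≤ 1)
    (hC : ContinuousOn C {v : V | 1 - ε < ‖v‖ ∧ ‖v‖ < 1 + ε}) (hCid : ∀ u : V, ‖u‖ = 1 → C u = u)
    {κ : ℝ} (hκ : 0 < κ) :
    ∃ ε' : ℝ, 0 < ε' ∧ ε' < ε ∧ ∀ σ : ℝ, |σ - 1| ≤ ε' → ∀ u : V, u ≠ 0 →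
      ‖C (σ • (‖u‖⁻¹ • u)) - ‖u‖⁻¹ • u‖ < κ := by
  -- apply the uniform lemma on `[1 - ε/2, 1 + ε/2] × sphere` to `f(σ, u) = C(σ u) - u`
  have hε2 : 0 < ε / 2 := by linarith
  set f : ℝ × V → V := fun q ↦ C (q.1 • q.2) - q.2 with hf
  have hfc : ContinuousOn f (Icc (1 - ε / 2) (1 + ε / 2) ×ˢ Metric.sphere (0 : V) 1) := by
    refine ContinuousOn.sub ?_ continuous_snd.continuousOn
    refine hC.comp (continuous_fst.smul continuous_snd).continuousOn ?_
    rintro ⟨σ, u⟩ ⟨hσ, hu⟩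
    have hu1 : ‖u‖ = 1 := by simpa using hu
    have hσpos : 0 < σ := by linarith [hσ.1]
    simp only [mem_setOf_eq, norm_smul, Real.norm_eq_abs, abs_of_pos hσpos, hu1, mul_one]
    exact ⟨by linarith [hσ.1], by linarith [hσ.2]⟩
  have h0 : ∀ u ∈ Metric.sphere (0 : V) 1, f (1, u) = 0 := by
    intro u hu
    have hu1 : ‖u‖ = 1 := by simpa using hu
    simp [hf, hCid u hu1]
  obtain ⟨ε₁, hε₁, hε₁ε, hsmall⟩ :=
    exists_forall_norm_lt_near_one (isCompact_sphere (0 : V) 1) hε2 hfc h0 hκ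
  refine ⟨ε₁, hε₁, by linarith, fun σ hσ u hu ↦ ?_⟩
  have hn : ‖‖u‖⁻¹ • u‖ = 1 := by
    rw [norm_smul, norm_inv, norm_norm, inv_mul_cancel₀ (norm_ne_zero_iff.2 hu)]
  have h := hsmall σ hσ (‖u‖⁻¹ • u) (by simpa using hn)
  simpa [hf] using h

omit [FiniteDimensional ℝ V] in
/-- The point `σ N u` lies in the annulus `{1-ε' < ‖v‖ < 1+ε'}` for `|σ - 1| < ε'`, `u ≠ 0`.
[folklore] -/
theorem smul_normalize_mem_annulus {ε' σ : ℝ} (hσ : |σ - 1| < ε') (hε' : ε' < 1) {u : V}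
    (hu : u ≠ 0) :
    σ • (‖u‖⁻¹ • u) ∈ {v : V | 1 - ε' < ‖v‖ ∧ ‖v‖ < 1 + ε'} := by
  have hn : ‖‖u‖⁻¹ • u‖ = 1 := by
    rw [norm_smul, norm_inv, norm_norm, inv_mul_cancel₀ (norm_ne_zero_iff.2 hu)]
  have hσpos : 0 < σ := by linarith [(abs_lt.1 hσ).1]
  simp only [mem_setOf_eq, norm_smul, Real.norm_eq_abs, abs_of_pos hσpos, hn, mul_one]
  exact ⟨by linarith [(abs_lt.1 hσ).1], by linarith [(abs_lt.1 hσ).2]⟩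

omit [FiniteDimensional ℝ V] in
/-- **The radial defect `d(σ, u) = ‖C(σ N u)‖ - σ` is `C¹`** on `(1-ε', 1+ε') × (V ∖ {0})` when
`C` is `C¹` on the annulus of width `ε' < 1` and does not vanish there. [folklore] -/
theorem contDiffOn_radialDefect {C : V → V} {ε' : ℝ} (hε'1 : ε' < 1) {n : WithTop ℕ∞}
    (hC : ContDiffOn ℝ n C {v : V | 1 - ε' < ‖v‖ ∧ ‖v‖ < 1 + ε'})
    (hC0 : ∀ v : V, 1 - ε' < ‖v‖ → ‖v‖ < 1 + ε' → C v ≠ 0) :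
    ContDiffOn ℝ n (fun q : ℝ × V ↦ ‖C (q.1 • (‖q.2‖⁻¹ • q.2))‖ - q.1)
      (Ioo (1 - ε') (1 + ε') ×ˢ {u : V | u ≠ 0}) := by
  have hA : IsOpen {v : V | 1 - ε' < ‖v‖ ∧ ‖v‖ < 1 + ε'} :=
    (isOpen_lt continuous_const continuous_norm).inter (isOpen_lt continuous_norm continuous_const)
  intro q hq
  obtain ⟨hσ, hu⟩ := hq
  have hu' : q.2 ≠ 0 := hu
  have hσ' : |q.1 - 1| < ε' := abs_lt.2 ⟨by linarith [hσ.1], by linarith [hσ.2]⟩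
  have hmem := smul_normalize_mem_annulus hσ' hε'1 hu'
  -- the inner map `q ↦ q.1 • N q.2`
  have hin : ContDiffAt ℝ n (fun q : ℝ × V ↦ q.1 • (‖q.2‖⁻¹ • q.2)) q :=
    contDiffAt_fst.smul ((contDiffAt_normalize hu').comp q contDiffAt_snd)
  have hCat : ContDiffAt ℝ n C (q.1 • (‖q.2‖⁻¹ • q.2)) := hC.contDiffAt (hA.mem_nhds hmem)
  have hcomp : ContDiffAt ℝ n (fun q : ℝ × V ↦ C (q.1 • (‖q.2‖⁻¹ • q.2))) q := hCat.comp q hin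
  have hnorm : ContDiffAt ℝ n (fun q : ℝ × V ↦ ‖C (q.1 • (‖q.2‖⁻¹ • q.2))‖) q :=
    hcomp.norm ℝ (hC0 _ hmem.1 hmem.2)
  exact (hnorm.sub contDiffAt_fst).contDiffWithinAt

omit [FiniteDimensional ℝ V] in
/-- **The angular drift `w(σ, u) = N(C(σ N u)) - N u` is `C¹`** on `(1-ε', 1+ε') × (V ∖ {0})`
under the same hypotheses. [folklore] -/
theorem contDiffOn_angularDrift {C : V → V} {ε' : ℝ} (hε'1 : ε' < 1) {n : WithTop ℕ∞}
    (hC : ContDiffOn ℝ n C {v : V | 1 - ε' < ‖v‖ ∧ ‖v‖ < 1 + ε'})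
    (hC0 : ∀ v : V, 1 - ε' < ‖v‖ → ‖v‖ < 1 + ε' → C v ≠ 0) :
    ContDiffOn ℝ n (fun q : ℝ × V ↦
      ‖C (q.1 • (‖q.2‖⁻¹ • q.2))‖⁻¹ • C (q.1 • (‖q.2‖⁻¹ • q.2)) - ‖q.2‖⁻¹ • q.2)
      (Ioo (1 - ε') (1 + ε') ×ˢ {u : V | u ≠ 0}) := by
  have hA : IsOpen {v : V | 1 - ε' < ‖v‖ ∧ ‖v‖ < 1 + ε'} :=
    (isOpen_lt continuous_const continuous_norm).inter (isOpen_lt continuous_norm continuous_const)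
  intro q hq
  obtain ⟨hσ, hu⟩ := hq
  have hu' : q.2 ≠ 0 := hu
  have hσ' : |q.1 - 1| < ε' := abs_lt.2 ⟨by linarith [hσ.1], by linarith [hσ.2]⟩
  have hmem := smul_normalize_mem_annulus hσ' hε'1 hu'
  have hN2 : ContDiffAt ℝ n (fun q : ℝ × V ↦ ‖q.2‖⁻¹ • q.2) q :=
    (contDiffAt_normalize hu').comp q contDiffAt_snd
  have hin : ContDiffAt ℝ n (fun q : ℝ × V ↦ q.1 • (‖q.2‖⁻¹ • q.2)) q := contDiffAt_fst.smul hN2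
  have hCat : ContDiffAt ℝ n C (q.1 • (‖q.2‖⁻¹ • q.2)) := hC.contDiffAt (hA.mem_nhds hmem)
  have hcomp : ContDiffAt ℝ n (fun q : ℝ × V ↦ C (q.1 • (‖q.2‖⁻¹ • q.2))) q := hCat.comp q hin
  have hNC : ContDiffAt ℝ n ((fun y : V ↦ ‖y‖⁻¹ • y) ∘ fun q : ℝ × V ↦
      C (q.1 • (‖q.2‖⁻¹ • q.2))) q :=
    (contDiffAt_normalize (hC0 _ hmem.1 hmem.2)).comp q hcomp
  exact (hNC.sub hN2).contDiffWithinAt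

omit [FiniteDimensional ℝ V] in
/-- `d(1, u) = 0` for `u ≠ 0`. [folklore] -/
theorem radialDefect_one {C : V → V} (hCid : ∀ u : V, ‖u‖ = 1 → C u = u) {u : V} (hu : u ≠ 0) :
    ‖C ((1 : ℝ) • (‖u‖⁻¹ • u))‖ - 1 = 0 := by
  have hn : ‖‖u‖⁻¹ • u‖ = 1 := by
    rw [norm_smul, norm_inv, norm_norm, inv_mul_cancel₀ (norm_ne_zero_iff.2 hu)]
  rw [one_smul, hCid _ hn, hn, sub_self]

omit [FiniteDimensional ℝ V] in
/-- `w(1, u) = 0` for `u ≠ 0`. [folklore] -/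
theorem angularDrift_one {C : V → V} (hCid : ∀ u : V, ‖u‖ = 1 → C u = u) {u : V} (hu : u ≠ 0) :
    ‖C ((1 : ℝ) • (‖u‖⁻¹ • u))‖⁻¹ • C ((1 : ℝ) • (‖u‖⁻¹ • u)) - ‖u‖⁻¹ • u = 0 := by
  have hn : ‖‖u‖⁻¹ • u‖ = 1 := by
    rw [norm_smul, norm_inv, norm_norm, inv_mul_cancel₀ (norm_ne_zero_iff.2 hu)]
  rw [one_smul, hCid _ hn, hn, inv_one, one_smul, sub_self]

/-- **Collar estimates.** For `C` of class `C¹` on the annulus of width `ε' < 1`, nonvanishing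
there, with `C u = u` on the unit sphere, and any `κ > 0`, there is `ε₁ ∈ (0, ε')` such that for
`|σ - 1| ≤ ε₁` and unit vectors `u, u'` with `‖u - u'‖ < 1`:
`|d(σ, u)| < κ`, `‖w(σ, u)‖ < κ`, `|d(σ, u') - d(σ, u)| ≤ κ‖u' - u‖`,
`‖w(σ, u') - w(σ, u)‖ ≤ κ‖u' - u‖`. [cite: Weinstein1968, proof of the main theorem, step (3)] -/
theorem exists_collar_estimates {C : V → V} {ε' : ℝ} (hε' : 0 < ε') (hε'1 : ε' < 1)
    (hC : ContDiffOn ℝ 1 C {v : V | 1 - ε' < ‖v‖ ∧ ‖v‖ < 1 + ε'})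
    (hC0 : ∀ v : V, 1 - ε' < ‖v‖ → ‖v‖ < 1 + ε' → C v ≠ 0)
    (hCid : ∀ u : V, ‖u‖ = 1 → C u = u) {κ : ℝ} (hκ : 0 < κ) :
    ∃ ε₁ : ℝ, 0 < ε₁ ∧ ε₁ < ε' ∧ ∀ σ : ℝ, |σ - 1| ≤ ε₁ →
      (∀ u : V, ‖u‖ = 1 → |‖C (σ • (‖u‖⁻¹ • u))‖ - σ| < κ ∧
        ‖‖C (σ • (‖u‖⁻¹ • u))‖⁻¹ • C (σ • (‖u‖⁻¹ • u)) - ‖u‖⁻¹ • u‖ < κ) ∧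
      (∀ u u' : V, ‖u‖ = 1 → ‖u'‖ = 1 → ‖u - u'‖ < 1 →
        |(‖C (σ • (‖u'‖⁻¹ • u'))‖ - σ) - (‖C (σ • (‖u‖⁻¹ • u))‖ - σ)| ≤ κ * ‖u' - u‖ ∧
        ‖(‖C (σ • (‖u'‖⁻¹ • u'))‖⁻¹ • C (σ • (‖u'‖⁻¹ • u')) - ‖u'‖⁻¹ • u') -
          (‖C (σ • (‖u‖⁻¹ • u))‖⁻¹ • C (σ • (‖u‖⁻¹ • u)) - ‖u‖⁻¹ • u)‖ ≤ κ * ‖u' - u‖) := by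
  set Φd : ℝ × V → ℝ := fun q ↦ ‖C (q.1 • (‖q.2‖⁻¹ • q.2))‖ - q.1 with hΦd
  set Φw : ℝ × V → V := fun q ↦
    ‖C (q.1 • (‖q.2‖⁻¹ • q.2))‖⁻¹ • C (q.1 • (‖q.2‖⁻¹ • q.2)) - ‖q.2‖⁻¹ • q.2 with hΦw
  have hd : ContDiffOn ℝ 1 Φd (Ioo (1 - ε') (1 + ε') ×ˢ {u : V | u ≠ 0}) :=
    contDiffOn_radialDefect hε'1 hC hC0
  have hw : ContDiffOn ℝ 1 Φw (Ioo (1 - ε') (1 + ε') ×ˢ {u : V | u ≠ 0}) :=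
    contDiffOn_angularDrift hε'1 hC hC0
  have hd0 : ∀ u : V, u ≠ 0 → Φd (1, u) = 0 := fun u hu ↦ radialDefect_one hCid hu
  have hw0 : ∀ u : V, u ≠ 0 → Φw (1, u) = 0 := fun u hu ↦ angularDrift_one hCid hu
  -- smallness of the values (on the sphere) and of the slice Lipschitz constants
  have hdc : ContinuousOn Φd (Icc (1 - ε' / 2) (1 + ε' / 2) ×ˢ Metric.sphere (0 : V) 1) := by
    refine hd.continuousOn.mono ?_
    rintro ⟨σ, u⟩ ⟨hσ, hu⟩
    refine ⟨⟨by linarith [hσ.1], by linarith [hσ.2]⟩, ?_⟩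
    have hu1 : ‖u‖ = 1 := by simpa using hu
    intro h0
    have h0' : u = 0 := h0
    rw [h0', norm_zero] at hu1; exact zero_ne_one hu1
  have hwc : ContinuousOn Φw (Icc (1 - ε' / 2) (1 + ε' / 2) ×ˢ Metric.sphere (0 : V) 1) := by
    refine hw.continuousOn.mono ?_
    rintro ⟨σ, u⟩ ⟨hσ, hu⟩
    refine ⟨⟨by linarith [hσ.1], by linarith [hσ.2]⟩, ?_⟩
    have hu1 : ‖u‖ = 1 := by simpa using hu
    intro h0
    have h0' : u = 0 := h0
    rw [h0', norm_zero] at hu1; exact zero_ne_one hu1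
  have hsph0 : ∀ u ∈ Metric.sphere (0 : V) 1, u ≠ 0 := by
    intro u hu h0
    have hu1 : ‖u‖ = 1 := by simpa using hu
    rw [h0, norm_zero] at hu1; exact zero_ne_one hu1
  have hε2 : 0 < ε' / 2 := by linarith
  obtain ⟨e₁, he₁, -, h₁⟩ := exists_forall_norm_lt_near_one (isCompact_sphere (0 : V) 1) hε2 hdc
    (fun u hu ↦ hd0 u (hsph0 u hu)) hκ
  obtain ⟨e₂, he₂, -, h₂⟩ := exists_forall_norm_lt_near_one (isCompact_sphere (0 : V) 1) hε2 hwc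
    (fun u hu ↦ hw0 u (hsph0 u hu)) hκ
  obtain ⟨e₃, he₃, he₃ε, h₃⟩ := exists_forall_slice_sub_le_near_one hε' hd hd0 hκ
  obtain ⟨e₄, he₄, -, h₄⟩ := exists_forall_slice_sub_le_near_one hε' hw hw0 hκ
  refine ⟨min (min e₁ e₂) (min e₃ e₄), by positivity, ?_, ?_⟩
  · exact lt_of_le_of_lt ((min_le_right _ _).trans (min_le_left _ _)) he₃ε
  intro σ hσ
  have hσ₁ : |σ - 1| ≤ e₁ := hσ.trans ((min_le_left _ _).trans (min_le_left _ _))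
  have hσ₂ : |σ - 1| ≤ e₂ := hσ.trans ((min_le_left _ _).trans (min_le_right _ _))
  have hσ₃ : |σ - 1| ≤ e₃ := hσ.trans ((min_le_right _ _).trans (min_le_left _ _))
  have hσ₄ : |σ - 1| ≤ e₄ := hσ.trans ((min_le_right _ _).trans (min_le_right _ _))
  constructor
  · intro u hu
    have huS : u ∈ Metric.sphere (0 : V) 1 := by simpa using hu
    have a := h₁ σ hσ₁ u huS
    have b := h₂ σ hσ₂ u huS
    rw [Real.norm_eq_abs] at a
    exact ⟨a, b⟩
  · intro u u' hu hu' hd'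
    have a := h₃ σ hσ₃ u u' hu hu' hd'
    have b := h₄ σ hσ₄ u u' hu hu' hd'
    rw [Real.norm_eq_abs] at a
    exact ⟨a, b⟩

end Literature.Geometry.Riemannian

end
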